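import Mathlib.MeasureTheory.Function.AbsolutelyContinuous
import Mathlib.MeasureTheory.Measure.Stieltjes
import Mathlib.MeasureTheory.Measure.Lebesgue.Basic
import Mathlib.MeasureTheory.Measure.Decomposition.RadonNikodym
import HarnessLib

/-!
# A continuous monotone function with a nearly-everywhere finite one-sided Dini derivate is
absolutely continuous

Stub `stub_acOfDini` of line `Sketch` for the crux `GronwallLeakage` (route WeilWindowFlow,
item stmt-RiemannHypothesis-1037): the GENERIC real-analysis engine, with no Weil-form content
and no `Summits.*` import.

**Statement** (`stub_acOfDini`). Let `f` be continuous and antitone on `[b, a]` (`b ≤ a`) and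
suppose that, outside a countable set `s`, every `x ∈ [b, a)` admits `M` with
`-(M h) ≤ f (x + h) - f x` for all small `h > 0` (finite lower-right Dini derivate). Then `f` is
absolutely continuous on `[b, a]` (`AbsolutelyContinuousOnInterval f b a`, Mathlib's `ε`–`δ`
notion).

**Proof** (measure-theoretic form of "continuous monotone + Lusin (N) ⟹ AC", Banach–Zarecki;
Saks, *Theory of the Integral*, Ch. VII §§6–10 and Ch. IX; Natanson, Ch. IX).
* Clamp and negate: `G x = -f (max b (min a x))` is monotone and continuous on `ℝ`, constant on
  `(-∞, b]` and on `[a, ∞)`; let `μ_G` be its Stieltjes measure (no atoms, by continuity).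
* Dini decomposition: every `x ∉ s` lies in some
  `E_{M,k} = {x | G (x + h) - G x ≤ (M + 1) h for 0 < h < 1/(k+1)}` (`M k : ℕ`).
* Key estimate (`measure_le_of_forall_sub_le`): a set `A ⊆ E_{M,k}` inside an interval
  `(c, d]` of length `≤ 1/(k+1)` has `μ_G A ≤ (M + 1) (d - c)` (`μ_G A ≤ G (sup A) - G (inf A)`
  and the increment bound at points of `A`, closed up by continuity at `inf A`).
* Lebesgue outer measure is `OuterMeasure.ofFunction` of the interval length
  (`Real.volume_eq_stieltjes_id`), so the key estimate gives
  `μ_G (Z ∩ E_{M,k} ∩ (c, d]) ≤ (M + 1) λ(Z)` for every `Z` (`measure_inter_le_mul_volume`);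
  with the grid `(j/(k+1), (j+1)/(k+1)]` and countability of `s` this yields `μ_G ≪ λ`.
* Radon–Nikodym: `G y - G x = μ_G (x, y] = ∫_x^y dμ_G/dλ` with `dμ_G/dλ ∈ L¹[b, a]`, and an
  indefinite integral of an integrable function is absolutely continuous
  (`IntervalIntegrable.absolutelyContinuousOnInterval_intervalIntegral`); on `[b, a]`,
  `f = f b - (G - G b)`.

Design: no new definitions (the Stieltjes function is built inline), helpers in the
sub-namespace `AcOfDini`; nothing here is specific to the Weil window flow. Not here: the
converse (AC ⟹ finite Dini derivates a.e.), Lusin's (N) as a named property, Vitali coverings.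
-/

-- `Summit.RiemannHypothesis.RiemannHypothesis.…` repeats a namespace component by design (D-0017 layout).
set_option linter.dupNamespace false

noncomputable section

open MeasureTheory Set Filter
open scoped Topology ENNReal NNReal

namespace Summit.RiemannHypothesis.RiemannHypothesis.Theorems.WeilWindowFlowGronwallLeakage

namespace AcOfDini

/-! ## Stieltjes measure of a continuous monotone function -/

/-- For a continuous Stieltjes function the left limit is the value. [folklore] -/
theorem leftLim_eq_of_continuous (G : StieltjesFunction ℝ) (hc : Continuous G) (x : ℝ) :
    Function.leftLim G x = G x :=
  (hc.continuousWithinAt (s := Iic x) (x := x)).leftLim_eq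

/-- The Stieltjes measure of a continuous monotone function on a closed interval. [folklore] -/
theorem measure_Icc_of_continuous (G : StieltjesFunction ℝ) (hc : Continuous G) (x y : ℝ) :
    G.measure (Icc x y) = ENNReal.ofReal (G y - G x) := by
  rw [StieltjesFunction.measure_Icc, leftLim_eq_of_continuous G hc]

/-- The Stieltjes measure of a continuous monotone function has no atoms. [folklore] -/
theorem nullSingletonClass_of_continuous (G : StieltjesFunction ℝ) (hc : Continuous G) :
    NullSingletonClass G.measure :=
  ⟨fun x => by rw [StieltjesFunction.measure_singleton, leftLim_eq_of_continuous G hc, sub_self,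
    ENNReal.ofReal_zero]⟩

/-- **Key one-sided Lipschitz estimate.** If every point `x` of a set `A`, contained in an
interval `(c, d]` of length at most `δ`, satisfies the right increment bound
`G (x + h) - G x ≤ C h` for `0 < h < δ`, then the Stieltjes measure of `A` is at most
`C (d - c)` (for continuous `G`): with `α = inf A`, `β = sup A`, `μ_G A ≤ G β - G α`, and
`G β - G x ≤ C (β - x)` for `x ∈ A` passes to the limit `x → α⁺` by continuity. [folklore] -/
theorem measure_le_of_forall_sub_le (G : StieltjesFunction ℝ) (hc : Continuous G) {C δ : ℝ}
    (hC : 0 ≤ C) {A : Set ℝ} {c d : ℝ} (hA : A ⊆ Ioc c d) (hdc : d - c ≤ δ)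
    (hE : ∀ x ∈ A, ∀ h : ℝ, 0 < h → h < δ → G (x + h) - G x ≤ C * h) :
    G.measure A ≤ ENNReal.ofReal (C * (d - c)) := by
  rcases A.eq_empty_or_nonempty with rfl | hne
  · simp
  have hbb : BddBelow A := ⟨c, fun x hx => (hA hx).1.le⟩
  have hba : BddAbove A := ⟨d, fun x hx => (hA hx).2⟩
  set α := sInf A with hα
  set β := sSup A with hβ
  have hβd : β ≤ d := csSup_le hne fun x hx => (hA hx).2
  have key : ∀ x ∈ A, G β - C * (β - x) ≤ G x := by
    intro x hx
    have hxβ : x ≤ β := le_csSup hba hx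
    rcases hxβ.eq_or_lt with h | h
    · rw [← h]; simp
    · have h1 : 0 < β - x := sub_pos.2 h
      have h2 : β - x < δ := by linarith [(hA hx).1]
      have := hE x hx (β - x) h1 h2
      rw [add_sub_cancel] at this
      linarith
  have hαmem : α ∈ closure A := csInf_mem_closure hne hbb
  have hle : G β - C * (β - α) ≤ G α :=
    le_on_closure (f := fun x => G β - C * (β - x)) (g := G) key (by fun_prop) hc.continuousOn hαmem
  have hαc : c ≤ α := le_csInf hne fun x hx => (hA hx).1.le
  calc G.measure A ≤ G.measure (Icc α β) :=
        measure_mono fun x hx => ⟨csInf_le hbb hx, le_csSup hba hx⟩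
    _ = ENNReal.ofReal (G β - G α) := measure_Icc_of_continuous G hc α β
    _ ≤ ENNReal.ofReal (C * (d - c)) := by
        apply ENNReal.ofReal_le_ofReal
        calc G β - G α ≤ C * (β - α) := by linarith
          _ ≤ C * (d - c) := mul_le_mul_of_nonneg_left (by linarith) hC

/-- `ℝ` has no bottom element: the auxiliary set `botSet` of the Stieltjes construction is
empty. [folklore] -/
theorem botSet_real_eq_empty : (botSet : Set ℝ) = ∅ := by
  ext x
  simp [botSet]

/-- Lebesgue outer measure on `ℝ` is the Stieltjes outer measure of the identity. [folklore] -/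
theorem volume_toOuterMeasure_eq_id_outer :
    (volume : Measure ℝ).toOuterMeasure = StieltjesFunction.id.outer := by
  rw [Real.volume_eq_stieltjes_id, StieltjesFunction.measure]

/-- **Comparison with Lebesgue measure.** Under the right increment bound on `E` (constant
`C > 0`, range `δ`), on every interval `(c, d]` of length `≤ δ` the Stieltjes measure restricted
to `E ∩ (c, d]` is dominated by `C • volume`, as outer measures: for every set `Z`,
`μ_G (Z ∩ (E ∩ (c, d])) ≤ C · λ(Z)`. (Lebesgue outer measure is `OuterMeasure.ofFunction` of
the interval length, so it suffices to test sets contained in one interval `(a', b']`, where the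
key estimate applies on `(c, d] ∩ (a', b']`.) [folklore] -/
theorem measure_inter_le_mul_volume (G : StieltjesFunction ℝ) (hc : Continuous G) {C δ : ℝ}
    (hC : 0 < C) {E : Set ℝ} (hE : ∀ x ∈ E, ∀ h : ℝ, 0 < h → h < δ → G (x + h) - G x ≤ C * h)
    {c d : ℝ} (hdc : d - c ≤ δ) (Z : Set ℝ) :
    G.measure (Z ∩ (E ∩ Ioc c d)) ≤ ENNReal.ofReal C * volume Z := by
  have h0 : ENNReal.ofReal C ≠ 0 := (ENNReal.ofReal_pos.2 hC).ne'
  have htop : ENNReal.ofReal C ≠ ∞ := ENNReal.ofReal_ne_top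
  have H : OuterMeasure.restrict (E ∩ Ioc c d) G.measure.toOuterMeasure ≤
      ENNReal.ofReal C • (volume : Measure ℝ).toOuterMeasure := by
    rw [volume_toOuterMeasure_eq_id_outer, StieltjesFunction.outer,
      OuterMeasure.smul_ofFunction htop, OuterMeasure.le_ofFunction]
    intro t
    simp only [OuterMeasure.restrict_apply, Pi.smul_apply, smul_eq_mul]
    rw [StieltjesFunction.length_eq, botSet_real_eq_empty, sdiff_empty]
    rw [ENNReal.mul_iInf_of_ne h0 htop]
    refine le_iInf fun a' => ?_
    rw [ENNReal.mul_iInf_of_ne h0 htop]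
    refine le_iInf fun b' => ?_
    rw [ENNReal.mul_iInf_of_ne h0 htop]
    refine le_iInf fun ht => ?_
    simp only [StieltjesFunction.id_apply, id_eq, Measure.coe_toOuterMeasure]
    calc G.measure (t ∩ (E ∩ Ioc c d))
        ≤ ENNReal.ofReal (C * (min b' d - max a' c)) := by
          refine measure_le_of_forall_sub_le G hc hC.le (δ := δ) ?_ ?_ ?_
          · intro x hx
            exact ⟨max_lt (ht hx.1).1 hx.2.2.1, le_min (ht hx.1).2 hx.2.2.2⟩
          · linarith [min_le_right b' d, le_max_right a' c]
          · intro x hx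
            exact hE x hx.2.1
      _ ≤ ENNReal.ofReal C * ENNReal.ofReal (b' - a') := by
          rw [← ENNReal.ofReal_mul hC.le]
          apply ENNReal.ofReal_le_ofReal
          apply mul_le_mul_of_nonneg_left _ hC.le
          linarith [min_le_left b' d, le_max_left a' c]
  have := H Z
  simpa only [OuterMeasure.restrict_apply, Measure.coe_toOuterMeasure, smul_apply,
    smul_eq_mul] using this

/-! ## Absolute continuity: two small closure properties -/

/-- Absolute continuity on `uIcc a b` only depends on the values on `uIcc a b`. [folklore] -/
theorem absolutelyContinuousOnInterval_congr {f g : ℝ → ℝ} {a b : ℝ}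
    (hfg : ∀ x ∈ uIcc a b, f x = g x) (hg : AbsolutelyContinuousOnInterval g a b) :
    AbsolutelyContinuousOnInterval f a b := by
  rw [absolutelyContinuousOnInterval_iff] at hg ⊢
  intro ε hε
  obtain ⟨δ, hδ, h⟩ := hg ε hε
  refine ⟨δ, hδ, fun E hE hlt => ?_⟩
  calc ∑ i ∈ Finset.range E.1, dist (f (E.2 i).1) (f (E.2 i).2)
      = ∑ i ∈ Finset.range E.1, dist (g (E.2 i).1) (g (E.2 i).2) :=
        Finset.sum_congr rfl fun i hi => by rw [hfg _ (hE.1 i hi).1, hfg _ (hE.1 i hi).2]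
    _ < ε := h E hE hlt

/-- Constants are absolutely continuous. [folklore] -/
theorem absolutelyContinuousOnInterval_const (c a b : ℝ) :
    AbsolutelyContinuousOnInterval (fun _ : ℝ => c) a b :=
  ((LipschitzWith.const c).lipschitzOnWith (s := uIcc a b)).absolutelyContinuousOnInterval

end AcOfDini

/-! ## The stub -/

open AcOfDini in
/-- **Stub `stub_acOfDini` (generic real analysis; Saks, *Theory of the Integral*, VII §§6–10,
IX; Natanson IX).** A continuous antitone function on `[b, a]` whose lower-right Dini derivate
is finite (`f (x + h) - f x ≥ -M h` for small `h > 0`) at every point of `[b, a)` outside a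
countable set is absolutely continuous on `[b, a]`.

Proof: clamp and negate to get a continuous monotone `G` on `ℝ`; off the countable set every
point lies in some `E_{M,k} = {x | G (x + h) - G x ≤ (M + 1) h for 0 < h < 1/(k+1)}`; the
Stieltjes measure `μ_G` restricted to `E_{M,k} ∩ (j/(k+1), (j+1)/(k+1)]` is `≤ (M + 1) λ`
(`measure_inter_le_mul_volume`) and `μ_G` has no atoms, so `μ_G ≪ λ`; by Radon–Nikodym
`G y - G x = ∫_x^y dμ_G/dλ`, an indefinite integral of an `L¹` function, hence absolutely
continuous. [folklore] -/
theorem stub_acOfDini :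
    ∀ (f : ℝ → ℝ) (b a : ℝ), b ≤ a → ContinuousOn f (Icc b a) → AntitoneOn f (Icc b a) →
      (∃ s : Set ℝ, s.Countable ∧ ∀ x ∈ Ico b a, x ∉ s →
        ∃ M : ℝ, ∀ᶠ h in 𝓝[>] (0 : ℝ), -(M * h) ≤ f (x + h) - f x) →
      AbsolutelyContinuousOnInterval f b a := by
  intro f b a hba hcont hanti hdini
  obtain ⟨s, hs, hdini⟩ := hdini
  -- the clamp `p x = max b (min a x) ∈ [b, a]` and the monotone continuous `G = -f ∘ p`
  set p : ℝ → ℝ := fun x => max b (min a x) with hp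
  have hp_mem : ∀ x, p x ∈ Icc b a := fun x => ⟨le_max_left _ _, max_le hba (min_le_left _ _)⟩
  have hp_mono : Monotone p := fun x y hxy => max_le_max le_rfl (min_le_min le_rfl hxy)
  have hp_id : ∀ x ∈ Icc b a, p x = x := fun x hx => by simp [hp, hx.2, hx.1]
  have hp_cont : Continuous p := by fun_prop
  set G : ℝ → ℝ := fun x => -f (p x) with hG
  have hGm : Monotone G := fun x y hxy => neg_le_neg (hanti (hp_mem x) (hp_mem y) (hp_mono hxy))
  have hGc : Continuous G := (hcont.comp_continuous hp_cont hp_mem).neg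
  let GS : StieltjesFunction ℝ := ⟨G, hGm, fun x => hGc.continuousWithinAt⟩
  have hGSc : Continuous GS := hGc
  -- the Dini sets
  set E : ℕ → ℕ → Set ℝ := fun M k =>
    {x | ∀ h : ℝ, 0 < h → h < 1 / ((k : ℝ) + 1) → G (x + h) - G x ≤ ((M : ℝ) + 1) * h} with hE
  have hcover : ∀ x, x ∉ s → ∃ M k : ℕ, x ∈ E M k := by
    intro x hxs
    rcases lt_or_ge x b with hxb | hxb
    · -- left of `b`: `G` is constant on `[x, b]`
      obtain ⟨k, hk⟩ := exists_nat_one_div_lt (sub_pos.2 hxb)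
      refine ⟨0, k, fun h hh hhk => ?_⟩
      have h1 : p (x + h) = b := by
        have : x + h ≤ b := by linarith
        simp [hp, min_eq_right (this.trans hba), this]
      have h2 : p x = b := by
        simp [hp, min_eq_right (hxb.le.trans hba), hxb.le]
      simp only [hG, h1, h2, sub_self]
      positivity
    rcases lt_or_ge x a with hxa | hxa
    · -- `x ∈ [b, a) \ s`: the Dini hypothesis
      obtain ⟨M, hM⟩ := hdini x ⟨hxb, hxa⟩ hxs
      obtain ⟨u, hu, hsub⟩ := mem_nhdsGT_iff_exists_Ioo_subset.1 hM
      obtain ⟨M', hM'⟩ := exists_nat_ge M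
      obtain ⟨k, hk⟩ := exists_nat_one_div_lt (lt_min (mem_Ioi.1 hu) (sub_pos.2 hxa))
      refine ⟨M', k, fun h hh hhk => ?_⟩
      have hlt : h < min u (a - x) := hhk.trans hk
      have hd : -(M * h) ≤ f (x + h) - f x := hsub ⟨hh, hlt.trans_le (min_le_left _ _)⟩
      have hxh : x + h ∈ Icc b a :=
        ⟨by linarith, by linarith [hlt.trans_le (min_le_right u (a - x))]⟩
      simp only [hG, hp_id x ⟨hxb, hxa.le⟩, hp_id (x + h) hxh]
      nlinarith
    · -- right of `a`: `G` is constant on `[a, ∞)`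
      refine ⟨0, 0, fun h hh _ => ?_⟩
      have h1 : p (x + h) = a := by
        have : a ≤ x + h := by linarith
        simp [hp, min_eq_left this, hba]
      have h2 : p x = a := by simp [hp, min_eq_left hxa, hba]
      simp only [hG, h1, h2, sub_self]
      positivity
  have hEb : ∀ M k : ℕ, ∀ x ∈ E M k, ∀ h : ℝ, 0 < h → h < 1 / ((k : ℝ) + 1) →
      GS (x + h) - GS x ≤ ((M : ℝ) + 1) * h := fun M k x hx => hx
  -- `μ_G ≪ λ`
  haveI : NullSingletonClass GS.measure := nullSingletonClass_of_continuous GS hGSc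
  have hAC : GS.measure ≪ volume := by
    refine Measure.AbsolutelyContinuous.mk fun Z _ hZ => ?_
    have hZcov : Z ⊆ s ∪ ⋃ (M : ℕ) (k : ℕ) (j : ℤ),
        Z ∩ (E M k ∩ Ioc ((j : ℝ) / ((k : ℝ) + 1)) (((j : ℝ) + 1) / ((k : ℝ) + 1))) := by
      intro x hx
      by_cases hxs : x ∈ s
      · exact Or.inl hxs
      obtain ⟨M, k, hxE⟩ := hcover x hxs
      have hk : (0 : ℝ) < (k : ℝ) + 1 := by positivity
      refine Or.inr (mem_iUnion.2 ⟨M, mem_iUnion.2 ⟨k, mem_iUnion.2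
        ⟨⌈x * ((k : ℝ) + 1)⌉ - 1, hx, hxE, ?_, ?_⟩⟩⟩)
      · rw [div_lt_iff₀ hk]
        push_cast
        linarith [Int.ceil_lt_add_one (x * ((k : ℝ) + 1))]
      · rw [le_div_iff₀ hk]
        push_cast
        linarith [Int.le_ceil (x * ((k : ℝ) + 1))]
    refine measure_mono_null hZcov (measure_union_null (hs.measure_zero _) ?_)
    refine measure_iUnion_null_iff.2 fun M => measure_iUnion_null_iff.2 fun k =>
      measure_iUnion_null_iff.2 fun j => ?_
    have hpos : (0 : ℝ) < (M : ℝ) + 1 := by positivity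
    have hk : (0 : ℝ) < (k : ℝ) + 1 := by positivity
    have := measure_inter_le_mul_volume GS hGSc hpos (hEb M k) (c := (j : ℝ) / ((k : ℝ) + 1))
      (d := ((j : ℝ) + 1) / ((k : ℝ) + 1)) (le_of_eq (by field_simp; ring)) Z
    rw [hZ, mul_zero] at this
    exact nonpos_iff_eq_zero.1 this
  -- Radon–Nikodym: `G y - G x = ∫_x^y ρ`, `ρ = dμ_G/dλ ∈ L¹_loc`
  have hρ : volume.withDensity (GS.measure.rnDeriv volume) = GS.measure :=
    Measure.withDensity_rnDeriv_eq _ _ hAC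
  have hfin : ∀ᵐ x ∂(volume : Measure ℝ), GS.measure.rnDeriv volume x < ∞ :=
    Measure.rnDeriv_lt_top _ _
  have hmeas : Measurable (GS.measure.rnDeriv volume) := Measure.measurable_rnDeriv _ _
  have hGint : ∀ x y : ℝ, x ≤ y →
      G y - G x = ∫ v in x..y, (GS.measure.rnDeriv volume v).toReal := by
    intro x y hxy
    rw [intervalIntegral.integral_of_le hxy, integral_toReal hmeas.aemeasurable
      (ae_restrict_of_ae hfin), ← withDensity_apply _ measurableSet_Ioc, hρ,
      StieltjesFunction.measure_Ioc, ENNReal.toReal_ofReal (sub_nonneg.2 (hGm hxy))]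
  have hm_int : IntervalIntegrable (fun v => (GS.measure.rnDeriv volume v).toReal) volume b a := by
    rw [intervalIntegrable_iff_integrableOn_Icc_of_le hba]
    refine integrable_toReal_of_lintegral_ne_top hmeas.aemeasurable ?_
    rw [← withDensity_apply _ measurableSet_Icc, hρ, measure_Icc_of_continuous GS hGSc]
    exact ENNReal.ofReal_ne_top
  have hI : AbsolutelyContinuousOnInterval
      (fun x => f b - ∫ v in b..x, (GS.measure.rnDeriv volume v).toReal) b a :=
    (absolutelyContinuousOnInterval_const (f b) b a).sub
      (hm_int.absolutelyContinuousOnInterval_intervalIntegral left_mem_uIcc)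
  refine absolutelyContinuousOnInterval_congr (fun x hx => ?_) hI
  rw [uIcc_of_le hba] at hx
  have := hGint b x hx.1
  simp only [hG, hp_id x hx, hp_id b (left_mem_Icc.2 hba)] at this
  linarith

end Summit.RiemannHypothesis.RiemannHypothesis.Theorems.WeilWindowFlowGronwallLeakage
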